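import Literature.MathematicalPhysics.QuantumFieldTheory.Balaban1983to89.B14Radii
import Summits.QuantumFields.BalabanUV.T4Continuum.Support.TermwiseAnalyticMarginShrink

/-!
# TermwiseAnalyticMarginLayered — leaf T.2 (SHRINK) of road P1 for row NE7 DISCHARGED from the PRINTED layered radii
# [Balaban1988Convergent] (2.34)–(2.39) p. 261 (tree `B14Radii`) modulo ONE displayed one-run input (S1): the
# complexified step substitution moves a configuration by at most the printed one-step room

Cell `pub-balaban`, rung (B)+1 sub-cell t4, lineage `b2b-balaban-t4-ne7-p1` (node U5 = NE7, road P1 = TERM-WISE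
matching; generation 20 = CRUX PROVER NE7 #1 under the coordinator ruling «YM REDIRECT» 2026-08-21), skeleton
`HOME/t4/b2b-balaban-t4-ne7-p1-g19/SKELETON-NE7-P1.md` v1.7.1 §2 NODE T leaf T.2 and its gen-20 crux edition
`HOME/t4/b2b-balaban-t4-ne7-p1-g20/ROUTE1-NE7.md`; companion `Support/TermwiseAnalyticMarginShrink` (the (SHRINK)
typing: hypotheses `hshrink`, `hsum`).  HONEST FRAMING (page 1): FIXED FINITE T⁴, rung (B)+1 = the `ε → 0` limit of
unit-scale averaged expectations, CONDITIONAL on BetaPertH and the nine spine estimates (0/9 proved); NOT infinite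
volume, NOT a mass gap, NOT the Clay problem.  NE7 is NOT PRINTED in [Balaban1984PropagatorsI]–[Balaban1989LargeFieldII]
and NOT proved here.  Every analytic input below is a HYPOTHESIS BINDER named in the statement; the theorems are
[folklore] bookkeeping (a geometric sum of the printed half-powers, a preimage, two inductions along a chain of maps,
ONE CALL of the companion's `lipBackground_of_shrinkingMargin`).  No definitions, no cite tags; nothing printed is
asserted — the printed radii enter only through the tree's typed letters `B14Radii.shrink` ∕ `B14Radii.room`.

WHY.  After gen 19 the OWN-OPEN list of road P1 was `{T.2 = (SHRINK)}` = the two hypotheses of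
`TermwiseAnalyticMarginShrink.lipBackground_of_shrinkingMargin`: `hshrink` (after one more later step the analyticity
domain still contains every point whose closed `d_k`-ball lay in the previous domain) and `hsum` (`Σ_{i<k} d_i ≤ ϱ₀∕2`),
typed from the PROSE of [Balaban1988Convergent] p. 277.  The ideation synthesis (`t4/ideate/NE7-WALL.md` v16 §3 item 5,
card `dimock` A(synth-Q2); bridge T101 of lineage t4-ne7-p2 g47) located the printed MECHANISM one level below the
prose: the LAYERED radii (2.34)–(2.39) p. 261 with coefficients `shrink β m = 1 − β(1 − 2^{−m})`, `m` = space index −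
layer index, `β = 1∕4`, whose consecutive differences `β·2^{−(m+1)}` (`B14Radii.shrink_sub_succ`) are exactly
«very small and exponentially decreasing in the number of steps» and sum to `β` (`B14Radii.sum_losses`,
`hasSum_losses`).  This file makes that bridge a tree theorem against road P1's binders:
* (SHRINK).`hsum` is DESIGN + KERNEL: with decrements `d_i := (shrink β i − shrink β (i+1))·ϱ₀` the partial sums are
  `(1 − shrink β k)·ϱ₀ ≤ β·ϱ₀ ≤ ϱ₀∕2` for every `0 ≤ β ≤ 1∕2` (§1) — no analytic content;
* (SHRINK).`hshrink` holds for the PULLED-BACK chain `D (k+1) = Φ_k⁻¹(D k)` (the scale-`j` term read as a function of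
  the field one later step further, `Φ_k` = the complexified substitution of [Balaban1988Convergent] (3.6) p. 266
  `U_k = (exp iηH_k·U′_{k+1})^{u⁻¹}`) as soon as `Φ_k` DISPLACES points by at most `d_k` (§2) — and that displacement
  bound on the COMPLEX space is the ONE remaining input **(S1)**: printed for REAL small fields only ((3.7)–(3.8)
  p. 266, tree `B14Sect3`), for the complex spaces only as prose (p. 276 «can be extended [as in (I.3.13)] to analytic
  functions defined on the corresponding spaces (3.43)», p. 277 «the exponential decay of the minimizing function H_k
  imply that this difference is still much greater than bounds on this function»).  (S1) is ONE-RUN (no comparison of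
  two cutoffs) and is the same input row NE9's Cauchy device consumes; it is NOT a piece of the two-run estimate NE7.
* analyticity and the creation bound are INHERITED along the chain by composition (§2), so the companion's `hhol`∕`hbd`
  on the final domain follow from the CREATION statement ((2.27)∕(2.28) p. 259 shape) plus differentiability of the
  substitutions on the pulled-back domains;
* (§3) a displacement of the printed (3.8)-TYPE `c·ε_{n+m}·L^{−2(n+m)}` (plaquette units of the unit lattice) FITS the
  printed room `B14Radii.room A β α_{0,n} L (n+m) n = A·β·2^{−(m+1)}·α_{0,n}·L^{−2n}` at EVERY later step `m` as soon as it
  fits at the innermost one (`c·ε_n ≤ A(β∕2)α_{0,n}`, i.e. `B14Radii.innermost_fits_iff` — from the printed exponents by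
  `B14Radii.fits_of_exponents` when `p₀ ≤ q₀`) and `ε` is non-increasing along the flow and `L² ≥ 2`: the scale factor
  `L^{2m}` beats the half-power `2^m` — summability of the shrink comes from SCALE, not from `ε_k` (whose sum diverges
  along the marginal flow).
CONSEQUENCE for the row (gen-20 crux edition): road P1's OWN-OPEN list of TWO-RUN content is EMPTY; T.2 = PRINTED
creation radii (2.27)∕(2.28) [hypothesis shape over NODE O] + PRINTED layered design (2.34)–(2.39) [KERNEL here] +
exponent bookkeeping (X12) [KERNEL, `B14Radii`] + (S1) [ONE-RUN hypothesis shape, located-unprinted, shared with row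
NE9] + this bookkeeping.

WHAT IS PROVED ([folklore]).
§1 `sum_layerDec_eq` ∕ `sum_layerDec_le` ∕ **`sum_layerDec_le_half`** — the decrements `(shrink β i − shrink β (i+1))·ϱ₀`
   are nonnegative, sum over `i < k` to `(1 − shrink β k)·ϱ₀ ≤ β·ϱ₀`, hence `≤ ϱ₀∕2` for `β ≤ 1∕2` (printed `β = 1∕4`:
   `≤ ϱ₀∕4`, `sum_layerDec_le_quarter`).
§2 `mem_succ_of_displacement` — (SHRINK).`hshrink` for a pulled-back chain from a displacement bound asked only where it
   is used (`closedBall z (d k) ⊆ D k → dist (Φ k z) z ≤ d k`); `half_radius_survives_layered` — half the creation radius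
   survives every later step (companion's `half_radius_survives` + §1); `differentiableOn_chain`, `norm_chain_le`,
   `chain_apply_eq` — analyticity, the bound and real values are inherited along `T (k+1) = T k ∘ Φ k`.
§3 `displacement_fits_room` — `c·ε(n+m)∕(L^{n+m})² ≤ room A β (α₀ n) L (n+m) n` for all `m` from the innermost fit,
   `Antitone ε`, `2 ≤ L²`; `displacement_fits_room_of_exponents` — the same from the printed letters
   `ε_n = g_nA₀x_n^{p₀}`, `α_{0,n} = g_nC₀x_n^{q₀}` with `p₀ ≤ q₀`, `c·A₀ ≤ A(β∕2)C₀` (`B14Radii.fits_of_exponents`).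
§4 **`lipBackground_of_layeredMargin`** — node T's `LipBackground EA W κ (fun g j => 8·E₀ ∕ ϱ₀ g j)` PRODUCED from: the
   creation margin about every embedded background (PRINTED shape), the pulled-back chain of the complexified
   substitutions with (S1) displacements `≤ (shrink β k − shrink β (k+1))·ϱ₀` and `0 ≤ β ≤ 1∕2`, the creation functional
   analytic and bounded by `E₀e^{−κd}` on the creation domain, the substitutions differentiable on the pulled-back domains,
   real values at the final step — ONE CALL of `lipBackground_of_shrinkingMargin`, its `hshrink`∕`hsum`∕`hhol`∕`hbd`
   DISCHARGED by §§1–2.  `lipBackground_of_layeredMargin_two` — the same with the constant spelled `4·(2E₀)∕ϱ₀`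
   (the literal `CU` of `T4TowerRateDischarge.polyLipGrowth_of_couplingMargin`).
§5 `toy_layered` — non-vacuity in `ℂ`: translations by exactly the room, a pulled-back chain of balls, a quadratic
   creation functional; every hypothesis of §2's survival theorem discharged with a genuinely moving chain.

NOT DELIVERED: (S1) for Bałaban's complexified substitutions (ONE-RUN, located-unprinted, shared with row NE9); the
creation radii and functionals for Bałaban's objects (NODE O).  NOT NE7 (spine 0/9 unchanged), NOT summit progress.
-/

noncomputable section

open Finset Metric
open scoped BigOperators

namespace Summit.QuantumFields.BalabanUV.T4Continuum.TermwiseAnalyticMarginLayered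

open Literature.MathematicalPhysics.QuantumFieldTheory.Balaban1983to89
open B14Radii (shrink shrink_sub_succ sum_losses one_sub_shrink room room_eq fits_of_exponents)
open T4OutputRate (Carriers Functional LipBackground)
open TermwiseAnalyticMarginShrink (half_radius_survives lipBackground_of_shrinkingMargin)

/-! ## §1 The layered decrements of (2.34)–(2.39): partial sums `(1 − shrink β k)·ϱ₀ ≤ β·ϱ₀` -/

section Layered

/-- The one-step decrement `(shrink β i − shrink β (i+1))·ϱ₀ = β·2^{−(i+1)}·ϱ₀` (`B14Radii.shrink_sub_succ`). [folklore] -/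
theorem layerDec_eq (β ϱ₀ : ℝ) (i : ℕ) :
    (shrink β i - shrink β (i + 1)) * ϱ₀ = β * (1 / 2 : ℝ) ^ (i + 1) * ϱ₀ := by
  rw [shrink_sub_succ]

/-- The decrements are nonnegative for `β ≥ 0`, `ϱ₀ ≥ 0`. [folklore] -/
theorem layerDec_nonneg {β ϱ₀ : ℝ} (hβ : 0 ≤ β) (hϱ : 0 ≤ ϱ₀) (i : ℕ) :
    0 ≤ (shrink β i - shrink β (i + 1)) * ϱ₀ := by
  rw [layerDec_eq]; positivity

/-- Telescoping (`B14Radii.sum_losses`): `Σ_{i<k} (shrink β i − shrink β (i+1))·ϱ₀ = (1 − shrink β k)·ϱ₀`. [folklore] -/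
theorem sum_layerDec_eq (β ϱ₀ : ℝ) (k : ℕ) :
    ∑ i ∈ range k, (shrink β i - shrink β (i + 1)) * ϱ₀ = (1 - shrink β k) * ϱ₀ := by
  rw [← sum_mul, sum_losses]

/-- The total shrink after any number of later steps is at most `β·ϱ₀` (`β, ϱ₀ ≥ 0`). [folklore] -/
theorem sum_layerDec_le {β ϱ₀ : ℝ} (hβ : 0 ≤ β) (hϱ : 0 ≤ ϱ₀) (k : ℕ) :
    ∑ i ∈ range k, (shrink β i - shrink β (i + 1)) * ϱ₀ ≤ β * ϱ₀ := by
  rw [sum_layerDec_eq, one_sub_shrink]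
  have h1 : (0 : ℝ) ≤ (1 / 2 : ℝ) ^ k := by positivity
  have h2 : β * (1 - (1 / 2 : ℝ) ^ k) ≤ β := by nlinarith
  exact mul_le_mul_of_nonneg_right h2 hϱ

/-- **(SHRINK).`hsum` FROM THE PRINTED DESIGN**: for `0 ≤ β ≤ 1∕2` the layered decrements keep
`Σ_{i<k} d_i ≤ ϱ₀∕2` at every `k` — the hypothesis `hsum` of `TermwiseAnalyticMarginShrink.half_radius_survives` ∕
`lipBackground_of_shrinkingMargin`, with no analytic content. [folklore] -/
theorem sum_layerDec_le_half {β ϱ₀ : ℝ} (hβ0 : 0 ≤ β) (hβ : β ≤ 1 / 2) (hϱ : 0 ≤ ϱ₀) (k : ℕ) :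
    ∑ i ∈ range k, (shrink β i - shrink β (i + 1)) * ϱ₀ ≤ ϱ₀ / 2 :=
  (sum_layerDec_le hβ0 hϱ k).trans (by nlinarith)

/-- The printed choice `β = 1∕4` (p. 261) loses at most a QUARTER of the creation radius over all later steps. [folklore] -/
theorem sum_layerDec_le_quarter {ϱ₀ : ℝ} (hϱ : 0 ≤ ϱ₀) (k : ℕ) :
    ∑ i ∈ range k, (shrink (1 / 4) i - shrink (1 / 4) (i + 1)) * ϱ₀ ≤ ϱ₀ / 4 :=
  (sum_layerDec_le (by norm_num) hϱ k).trans (by linarith)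

end Layered

/-! ## §2 The pulled-back chain: (SHRINK).`hshrink` from a displacement bound; inheritance by composition -/

section Chain

variable {E : Type*}

/-- **(SHRINK).`hshrink` FROM A DISPLACEMENT BOUND (input (S1)).**  Along a pulled-back chain `D (k+1) = Φ k ⁻¹' D k`,
if the substitution `Φ k` moves every point whose closed `d k`-ball lies in `D k` by at most `d k`, then such a point
lies in `D (k+1)`. [folklore] -/
theorem mem_succ_of_displacement [PseudoMetricSpace E] (D : ℕ → Set E) (Φ : ℕ → E → E) (d : ℕ → ℝ)
    (hD : ∀ k, D (k + 1) = Φ k ⁻¹' D k)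
    (hΦ : ∀ k z, closedBall z (d k) ⊆ D k → dist (Φ k z) z ≤ d k) :
    ∀ k z, closedBall z (d k) ⊆ D k → z ∈ D (k + 1) := by
  intro k z hz
  rw [hD k, Set.mem_preimage]
  exact hz (mem_closedBall.2 (hΦ k z hz))

/-- **HALF THE CREATION RADIUS SURVIVES EVERY LATER STEP** along a pulled-back chain whose substitutions displace by at
most the layered decrements `(shrink β k − shrink β (k+1))·ϱ₀`, `0 ≤ β ≤ 1∕2` (companion's `half_radius_survives`,
its `hshrink` from `mem_succ_of_displacement`, its `hsum` from §1). [folklore] -/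
theorem half_radius_survives_layered [PseudoMetricSpace E] (D : ℕ → Set E) (Φ : ℕ → E → E) (x : E)
    {β ϱ₀ : ℝ} (hβ0 : 0 ≤ β) (hβ : β ≤ 1 / 2) (hϱ : 0 ≤ ϱ₀) (h0 : closedBall x ϱ₀ ⊆ D 0)
    (hD : ∀ k, D (k + 1) = Φ k ⁻¹' D k)
    (hΦ : ∀ k z, closedBall z ((shrink β k - shrink β (k + 1)) * ϱ₀) ⊆ D k →
      dist (Φ k z) z ≤ (shrink β k - shrink β (k + 1)) * ϱ₀) (k : ℕ) :
    closedBall x (ϱ₀ / 2) ⊆ D k :=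
  half_radius_survives D (fun i => (shrink β i - shrink β (i + 1)) * ϱ₀) x h0
    (mem_succ_of_displacement D Φ _ hD hΦ) (sum_layerDec_le_half hβ0 hβ hϱ) k

/-- Analyticity is inherited along the chain `T (k+1) = T k ∘ Φ k` on the pulled-back domains. [folklore] -/
theorem differentiableOn_chain [NormedAddCommGroup E] [NormedSpace ℂ E] (D : ℕ → Set E) (Φ : ℕ → E → E)
    (T : ℕ → E → ℂ) (hD : ∀ k, D (k + 1) = Φ k ⁻¹' D k) (hT0 : DifferentiableOn ℂ (T 0) (D 0))
    (hT : ∀ k, T (k + 1) = T k ∘ Φ k) (hΦ : ∀ k, DifferentiableOn ℂ (Φ k) (D (k + 1))) :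
    ∀ k, DifferentiableOn ℂ (T k) (D k) := by
  intro k
  induction k with
  | zero => exact hT0
  | succ k ih =>
      rw [hT k]
      refine ih.comp (hΦ k) ?_
      intro z hz
      rw [hD k] at hz
      exact hz

/-- The creation bound is inherited along the chain. [folklore] -/
theorem norm_chain_le (D : ℕ → Set E) (Φ : ℕ → E → E) (T : ℕ → E → ℂ) {B : ℝ}
    (hD : ∀ k, D (k + 1) = Φ k ⁻¹' D k) (hB : ∀ z ∈ D 0, ‖T 0 z‖ ≤ B) (hT : ∀ k, T (k + 1) = T k ∘ Φ k) :
    ∀ k, ∀ z ∈ D k, ‖T k z‖ ≤ B := by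
  intro k
  induction k with
  | zero => exact hB
  | succ k ih =>
      intro z hz
      rw [hT k, Function.comp_apply]
      rw [hD k] at hz
      exact ih _ hz

/-- The value along the chain is the creation functional at the iterated substitution:
`T k z = T 0 (Φ 0 (Φ 1 (⋯ (Φ (k−1) z))))`, stated as the one-step recursion it is used in. [folklore] -/
theorem chain_apply_eq (Φ : ℕ → E → E) (T : ℕ → E → ℂ) (hT : ∀ k, T (k + 1) = T k ∘ Φ k) (k : ℕ) (z : E) :
    T (k + 1) z = T k (Φ k z) := by
  rw [hT k, Function.comp_apply]

end Chain

/-! ## §3 A displacement of the printed (3.8)-type fits the printed room at every later step -/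

section Fit

/-- **SCALE BEATS THE HALF-POWERS.**  A displacement of plaquette size `c·ε_{n+m}·L^{−2(n+m)}` (unit-lattice units;
the (3.8) p. 266 TYPE, `η = L^{−(n+m)}`) at the `m`-th later step of a term created at layer `n` fits into the printed
room `B14Radii.room A β α_{0,n} L (n+m) n = A·β·2^{−(m+1)}·α_{0,n}·L^{−2n}` for EVERY `m`, as soon as it fits at the
innermost step (`c·ε_n ≤ A(β∕2)α_{0,n}`, `B14Radii.innermost_fits_iff`), `ε` is non-increasing along the flow, and
`L² ≥ 2`. [folklore] -/
theorem displacement_fits_room {A β c L : ℝ} {ε α₀ : ℕ → ℝ} (hA : 0 ≤ A) (hβ : 0 ≤ β) (hc : 0 ≤ c) (hL : 0 < L)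
    (hL2 : 2 ≤ L ^ 2) (hε : Antitone ε) (hα : ∀ n, 0 ≤ α₀ n)
    (h0 : ∀ n, c * ε n ≤ A * (β / 2) * α₀ n) (n m : ℕ) :
    c * ε (n + m) / (L ^ (n + m)) ^ 2 ≤ room A β (α₀ n) L (n + m) n := by
  rw [room_eq (Nat.le_add_right n m), Nat.add_sub_cancel_left]
  have hLn : 0 < (L ^ n) ^ 2 := by positivity
  have hLm : 0 < (L ^ m) ^ 2 := by positivity
  -- reduce to the layer-free comparison `c ε(n+m) / (L^m)^2 ≤ A β (1/2)^(m+1) α₀ n`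
  have hpow : (L ^ (n + m)) ^ 2 = (L ^ n) ^ 2 * (L ^ m) ^ 2 := by rw [pow_add]; ring
  rw [hpow, div_le_div_iff₀ (by positivity) hLn]
  -- `2^m ≤ (L^2)^m = (L^m)^2`
  have h2m : (2 : ℝ) ^ m ≤ (L ^ m) ^ 2 := by
    rw [← pow_mul, mul_comm, pow_mul]
    exact pow_le_pow_left₀ (by norm_num) hL2 m
  have hεm : c * ε (n + m) ≤ c * ε n := mul_le_mul_of_nonneg_left (hε (Nat.le_add_right n m)) hc
  have hkey : c * ε (n + m) ≤ A * (β * (1 / 2 : ℝ) ^ (m + 1)) * α₀ n * (L ^ m) ^ 2 := by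
    have h1 : c * ε (n + m) ≤ A * (β / 2) * α₀ n := hεm.trans (h0 n)
    have h2 : A * (β / 2) * α₀ n ≤ A * (β / 2) * α₀ n * (L ^ m) ^ 2 / 2 ^ m := by
      have hαn := hα n
      rw [le_div_iff₀ (by positivity)]
      exact mul_le_mul_of_nonneg_left h2m (by positivity)
    have h3 : A * (β / 2) * α₀ n * (L ^ m) ^ 2 / 2 ^ m = A * (β * (1 / 2 : ℝ) ^ (m + 1)) * α₀ n * (L ^ m) ^ 2 := by
      rw [pow_succ, one_div_pow]
      field_simp
      ring
    linarith [h1, h2, h3.le, h3.ge]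
  calc c * ε (n + m) * (L ^ n) ^ 2 ≤ A * (β * (1 / 2 : ℝ) ^ (m + 1)) * α₀ n * (L ^ m) ^ 2 * (L ^ n) ^ 2 :=
        mul_le_mul_of_nonneg_right hkey hLn.le
    _ = A * (β * (1 / 2 : ℝ) ^ (m + 1)) * α₀ n * ((L ^ n) ^ 2 * (L ^ m) ^ 2) := by ring

/-- The same fit from the PRINTED LETTERS: `ε_n = g_nA₀x_n^{p₀}` ((2.4) p. 255), `α_{0,n} = g_nC₀x_n^{q₀}` ((2.28) p. 259),
`x_n = log g_n^{−2} ≥ 1`, with the cell's reconstructed exponent restriction `p₀ ≤ q₀` and `c·A₀ ≤ A(β∕2)C₀`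
(`B14Radii.fits_of_exponents`), `ε` non-increasing along the flow, `L² ≥ 2`. [folklore] -/
theorem displacement_fits_room_of_exponents {A β c L A₀ C₀ : ℝ} {g x : ℕ → ℝ} {p₀ q₀ : ℕ} (hA : 0 ≤ A)
    (hβ : 0 ≤ β) (hc : 0 ≤ c) (hL : 0 < L) (hL2 : 2 ≤ L ^ 2) (hA₀ : 0 ≤ A₀) (hC₀ : 0 ≤ C₀)
    (hg : ∀ n, 0 ≤ g n) (hx : ∀ n, 1 ≤ x n) (hpq : p₀ ≤ q₀) (hC : c * A₀ ≤ A * (β / 2) * C₀)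
    (hε : Antitone fun n => g n * A₀ * x n ^ p₀) (n m : ℕ) :
    c * (g (n + m) * A₀ * x (n + m) ^ p₀) / (L ^ (n + m)) ^ 2 ≤ room A β (g n * C₀ * x n ^ q₀) L (n + m) n :=
  displacement_fits_room (ε := fun n => g n * A₀ * x n ^ p₀) (α₀ := fun n => g n * C₀ * x n ^ q₀) hA hβ hc hL hL2
    hε (fun n => by have := hg n; have : 0 ≤ x n := zero_le_one.trans (hx n); positivity)
    (fun n => fits_of_exponents hc hA₀ (hg n) (hx n) hpq hC) n m

end Fit

/-! ## §4 Node T's `LipBackground` from the creation margin, the layered design and (S1) -/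

section Lip

variable {C : Carriers} {E : Type*} [NormedAddCommGroup E] [NormedSpace ℂ E]

/-- **`LipBackground` FROM THE LAYERED MARGIN.**  For every admissible coupling sequence `g` and domain `X` (created at
scale `j = C.scale X`): an embedding `ι` of run-A backgrounds into a complex normed space dominated by the carrier's
gauge; a creation radius `ϱ₀ g j > 0` with the CREATION MARGIN `closedBall (ι U) (ϱ₀ g (scale X)) ⊆ Dch g X 0` about
every background (PRINTED shape (2.27)∕(2.28) p. 259 — a hypothesis); the PULLED-BACK CHAIN `Dch g X (k+1) =
Φ g X k ⁻¹' Dch g X k` of the complexified substitutions `Φ g X k` of the later steps, each DISPLACING by at most the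
printed layered room `(shrink β k − shrink β (k+1))·ϱ₀ g (scale X)` where it matters — **input (S1)**, ONE-RUN,
located-unprinted — with `0 ≤ β ≤ 1∕2` (printed `β = 1∕4`); the complexified functional `Ec g X k` after `k` later steps
given by composition `Ec g X (k+1) = Ec g X k ∘ Φ g X k`, the creation functional differentiable on the creation domain
and bounded there by `E₀e^{−κd X}`, the substitutions differentiable on the pulled-back domains, and the real values at
embedded backgrounds read at the final step `N g X`.  THEN `LipBackground EA W κ (fun g j => 8·E₀ ∕ ϱ₀ g j)` — ONE CALL of
`lipBackground_of_shrinkingMargin` with its four T.2 hypotheses `hshrink`∕`hsum`∕`hhol`∕`hbd` DISCHARGED. [folklore] -/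
theorem lipBackground_of_layeredMargin {EA : Functional C C.BgA} {W : Set (ℕ → ℝ)} {κ E₀ β : ℝ}
    (ι : C.BgA → E) (Dch : (ℕ → ℝ) → C.Dom → ℕ → Set E) (Φ : (ℕ → ℝ) → C.Dom → ℕ → E → E)
    (N : (ℕ → ℝ) → C.Dom → ℕ) (ϱ₀ : (ℕ → ℝ) → ℕ → ℝ) (Ec : (ℕ → ℝ) → C.Dom → ℕ → E → ℂ)
    (hβ0 : 0 ≤ β) (hβ : β ≤ 1 / 2) (hϱ₀ : ∀ g ∈ W, ∀ j, 0 < ϱ₀ g j)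
    (hcreate : ∀ g ∈ W, ∀ (X : C.Dom) (U : C.BgA), closedBall (ι U) (ϱ₀ g (C.scale X)) ⊆ Dch g X 0)
    (hD : ∀ g ∈ W, ∀ (X : C.Dom) (k : ℕ), Dch g X (k + 1) = Φ g X k ⁻¹' Dch g X k)
    (hdisp : ∀ g ∈ W, ∀ (X : C.Dom) (k : ℕ) (z : E),
      closedBall z ((shrink β k - shrink β (k + 1)) * ϱ₀ g (C.scale X)) ⊆ Dch g X k →
        dist (Φ g X k z) z ≤ (shrink β k - shrink β (k + 1)) * ϱ₀ g (C.scale X))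
    (hT : ∀ g ∈ W, ∀ (X : C.Dom) (k : ℕ), Ec g X (k + 1) = Ec g X k ∘ Φ g X k)
    (hhol0 : ∀ g ∈ W, ∀ X : C.Dom, DifferentiableOn ℂ (Ec g X 0) (Dch g X 0))
    (hΦhol : ∀ g ∈ W, ∀ (X : C.Dom) (k : ℕ), DifferentiableOn ℂ (Φ g X k) (Dch g X (k + 1)))
    (hbd0 : ∀ g ∈ W, ∀ X : C.Dom, ∀ z ∈ Dch g X 0, ‖Ec g X 0 z‖ ≤ E₀ * Real.exp (-(κ * C.d X)))
    (hreal : ∀ g ∈ W, ∀ (X : C.Dom) (U : C.BgA), Ec g X (N g X) (ι U) = (EA g U X : ℂ))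
    (hgauge : ∀ U U' : C.BgA, ‖ι U - ι U'‖ ≤ C.gauge U U') :
    LipBackground EA W κ (fun g j => 8 * E₀ / ϱ₀ g j) :=
  lipBackground_of_shrinkingMargin (EA := EA) (W := W) (κ := κ) (E₀ := E₀) ι Dch N ϱ₀
    (fun g X k => (shrink β k - shrink β (k + 1)) * ϱ₀ g (C.scale X)) (fun g X => Ec g X (N g X)) hϱ₀ hcreate
    (fun g hg X => mem_succ_of_displacement (Dch g X) (Φ g X) _ (hD g hg X) (hdisp g hg X))
    (fun g hg X k => sum_layerDec_le_half hβ0 hβ (hϱ₀ g hg (C.scale X)).le k)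
    (fun g hg X => differentiableOn_chain (Dch g X) (Φ g X) (Ec g X) (hD g hg X) (hhol0 g hg X) (hT g hg X)
      (hΦhol g hg X) (N g X))
    (fun g hg X => norm_chain_le (Dch g X) (Φ g X) (Ec g X) (hD g hg X) (hbd0 g hg X) (hT g hg X) (N g X))
    hreal hgauge

/-- `lipBackground_of_layeredMargin` with its constant spelled `4·(2E₀)∕ϱ₀` — LITERALLY the `CU` of
`T4TowerRateDischarge.polyLipGrowth_of_couplingMargin` at `E₀ := 2E₀`, so node T's producers compose BY NAME. [folklore] -/
theorem lipBackground_of_layeredMargin_two {EA : Functional C C.BgA} {W : Set (ℕ → ℝ)} {κ E₀ β : ℝ}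
    (ι : C.BgA → E) (Dch : (ℕ → ℝ) → C.Dom → ℕ → Set E) (Φ : (ℕ → ℝ) → C.Dom → ℕ → E → E)
    (N : (ℕ → ℝ) → C.Dom → ℕ) (ϱ₀ : (ℕ → ℝ) → ℕ → ℝ) (Ec : (ℕ → ℝ) → C.Dom → ℕ → E → ℂ)
    (hβ0 : 0 ≤ β) (hβ : β ≤ 1 / 2) (hϱ₀ : ∀ g ∈ W, ∀ j, 0 < ϱ₀ g j)
    (hcreate : ∀ g ∈ W, ∀ (X : C.Dom) (U : C.BgA), closedBall (ι U) (ϱ₀ g (C.scale X)) ⊆ Dch g X 0)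
    (hD : ∀ g ∈ W, ∀ (X : C.Dom) (k : ℕ), Dch g X (k + 1) = Φ g X k ⁻¹' Dch g X k)
    (hdisp : ∀ g ∈ W, ∀ (X : C.Dom) (k : ℕ) (z : E),
      closedBall z ((shrink β k - shrink β (k + 1)) * ϱ₀ g (C.scale X)) ⊆ Dch g X k →
        dist (Φ g X k z) z ≤ (shrink β k - shrink β (k + 1)) * ϱ₀ g (C.scale X))
    (hT : ∀ g ∈ W, ∀ (X : C.Dom) (k : ℕ), Ec g X (k + 1) = Ec g X k ∘ Φ g X k)
    (hhol0 : ∀ g ∈ W, ∀ X : C.Dom, DifferentiableOn ℂ (Ec g X 0) (Dch g X 0))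
    (hΦhol : ∀ g ∈ W, ∀ (X : C.Dom) (k : ℕ), DifferentiableOn ℂ (Φ g X k) (Dch g X (k + 1)))
    (hbd0 : ∀ g ∈ W, ∀ X : C.Dom, ∀ z ∈ Dch g X 0, ‖Ec g X 0 z‖ ≤ E₀ * Real.exp (-(κ * C.d X)))
    (hreal : ∀ g ∈ W, ∀ (X : C.Dom) (U : C.BgA), Ec g X (N g X) (ι U) = (EA g U X : ℂ))
    (hgauge : ∀ U U' : C.BgA, ‖ι U - ι U'‖ ≤ C.gauge U U') :
    LipBackground EA W κ (fun g j => 4 * (2 * E₀) / ϱ₀ g j) := by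
  have h := lipBackground_of_layeredMargin (EA := EA) (W := W) (κ := κ) (E₀ := E₀) ι Dch Φ N ϱ₀ Ec hβ0 hβ hϱ₀ hcreate
    hD hdisp hT hhol0 hΦhol hbd0 hreal hgauge
  have e : (fun g j => 8 * E₀ / ϱ₀ g j) = fun g j => 4 * (2 * E₀) / ϱ₀ g j := by
    funext g j
    ring
  rw [← e]
  exact h

end Lip

/-! ## §5 Non-vacuity: a genuinely moving pulled-back chain in `ℂ` -/

section Toy

/-- TOY (non-vacuity of §2 with the printed `β = 1∕4` and `ϱ₀ = 4`).  Substitutions = translations of `ℂ` by EXACTLY the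
room `(shrink ¼ k − shrink ¼ (k+1))·4 = 2^{−(k+1)}` (real, positive — the chain really moves), domains = the pulled-back
chain from the creation ball `closedBall 0 4`; every hypothesis of `half_radius_survives_layered` is discharged and the
ball `closedBall 0 2` survives all later steps. [folklore] -/
theorem toy_layered :
    let Φ : ℕ → ℂ → ℂ := fun k z => z + (((shrink (1 / 4) k - shrink (1 / 4) (k + 1)) * 4 : ℝ) : ℂ)
    let D : ℕ → Set ℂ := fun k => Nat.rec (closedBall (0 : ℂ) 4) (fun k S => Φ k ⁻¹' S) k
    (∀ k, D (k + 1) = Φ k ⁻¹' D k) ∧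
    (∀ k z, dist (Φ k z) z = (shrink (1 / 4) k - shrink (1 / 4) (k + 1)) * 4) ∧
    (∀ k, 0 < (shrink (1 / 4) k - shrink (1 / 4) (k + 1)) * 4) ∧
    (∀ k, closedBall (0 : ℂ) (4 / 2) ⊆ D k) := by
  intro Φ D
  have hD : ∀ k, D (k + 1) = Φ k ⁻¹' D k := fun k => rfl
  have hdist : ∀ k z, dist (Φ k z) z = (shrink (1 / 4) k - shrink (1 / 4) (k + 1)) * 4 := by
    intro k z
    have hnn : 0 ≤ (shrink (1 / 4) k - shrink (1 / 4) (k + 1)) * 4 :=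
      layerDec_nonneg (by norm_num) (by norm_num) k
    simp only [Φ, dist_eq_norm, add_sub_cancel_left, Complex.norm_real, Real.norm_eq_abs, abs_of_nonneg hnn]
  have hpos : ∀ k, 0 < (shrink (1 / 4) k - shrink (1 / 4) (k + 1)) * 4 := fun k => by
    rw [layerDec_eq]; positivity
  refine ⟨hD, hdist, hpos, ?_⟩
  intro k
  exact half_radius_survives_layered D Φ 0 (β := 1 / 4) (ϱ₀ := 4) (by norm_num) (by norm_num) (by norm_num)
    (by simp [D]) hD (fun k z _ => (hdist k z).le) k

end Toy

end Summit.QuantumFields.BalabanUV.T4Continuum.TermwiseAnalyticMarginLayered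

end
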